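import Mathlib
import HarnessLib
import Summits.Langlands.Langlands.Theses.MirrorPairReflection

/-!
# Alternative skeleton for crux stmt-Langlands-12834
`Summit.Langlands.Langlands.Theses.MirrorPairReflection.NonSelfMirrorReducible` — line `derham`
(crux-strategist seat `planner-cstrat-stmt-Langlands-12834-s2-0`, 2026-08-17).  It does NOT replace
the live skeleton `Lines/birth.lean`; it is the Hodge-type cut of the same crux, written so that the
continuation lead (or the harness's final-cycle split, D-0027 A7) can switch to it.

The cut is by the `p`-adic Hodge type of `σ` at `p`, typed over the route file's own import closure
(`Literature.NumberTheory.PAdicHodge.fontainePstAdicCompletion`, `PstWeilDeligneData.IsDeRhamFramed`,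
`FramedGaloisRep.toLocal`):

* `stub_deRham` — **the de Rham (geometric) piece**: the crux for `σ` de Rham at `p`.  PROTECTED by
  the Fontaine–Mazur conjecture (an irreducible geometric even `σ` would be automorphic, hence odd);
  ordinary regular sub-case = the target sector of route `EvenSkinnerWilesMirror` (Skinner–Wiles over
  an imaginary quadratic field; shared crux stmt-Langlands-12918); non-ordinary regular sub-case open;
  equal-weights sub-case = finite-ramification Fontaine–Mazur + birth's stubs 1–2.  OPEN but believed.
* `stub_notDeRham` — **the non-de Rham (wild) piece**: the crux for `σ` NOT de Rham at `p`.  This is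
  the whole non-geometric rigidity bet; by the strategist's census
  (`Cruxes/NonSelfMirrorReducible/STRATEGY-CENSUS.md` §§0–1) it is, at every genuine mirror pair in
  the model case `r = λ = 1` (every case below `2^31`), INCOMPATIBLE with the finiteness of the
  characteristic-`p` even deformation ring (`R'(ρ̄₁) ≅ ℤ_p[[y]]/(y·H(y))`, `p ∣ H(0)`; Mazur,
  Böckle 1999 Thm 4.14) — i.e. EXPECTED FALSE wherever its hypothesis is inhabited, true only if no
  mirror pair exists.  Filed as a stub so that the bet is quarantined, not so that provers attack it.
* `NonSelfMirrorReducible_of` — the composition, kernel-checked, no `sorry`: excluded middle on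
  "`σ` is de Rham at `p`".  Concludes the route decl BY NAME.

Why this dodges the stuck goal of `birth`: birth's open core `stub_infiniteProjectiveImage_rigidity`
mixes the FM-protected geometric `σ` with the non-geometric ones; the normal form of the census
shows every irreducible `σ` of the type is Lie-open, so that stub is the whole crux.  Here the
provable-in-principle half (`stub_deRham`) is separated from the expected-false half.

Disproof used: none on file (no `Disproof.lean`, no `Negative/` lemma; negatives index empty in
this sector) — 2026-08-17.  Candidate Theorems-file form of the composition (no stubs, the two
pieces as hypotheses) is attached as evidence on the item
(`MirrorPairReflectionNonSelfMirrorReducibleSplit.lean`, rc 0).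
-/

set_option linter.dupNamespace false
set_option linter.unusedVariables false

noncomputable section

namespace Summit.Langlands.Langlands.Cruxes.NonSelfMirrorReducible.DeRham

open Summit.Langlands.Langlands.Theses.MirrorPairReflection

/-! ## 1. The two stubs -/

/-- **STUB 1 — the de Rham (geometric) piece.** `p` odd; `σ : Γ_ℚ → GL₂(ℚ̄_p)` continuous,
unramified outside `p`, residual type `(a,b)` (trace congruence), `a+b` even, `¬ (p−1) ∣ 2(b−a)`,
`p ∣ B_m`, `p ∣ B_{p−1−m}`, and `σ|_{Γ_{ℚ_p}}` de Rham for the summit's Fontaine datum at the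
`v ∣ p` ⟹ `σ` reducible.  Fontaine–Mazur-protected; ordinary regular case attackable through route
EvenSkinnerWilesMirror.  Size: open-problem (XL even in the ordinary case).
[cite: FontaineMazurGeometric1995, Conj. 1] [cite: SkinnerWiles1999, Introduction]
[cite: Calegari2011, Thm. 1.2] -/
theorem stub_deRham :
    ∀ (p : ℕ) [Fact p.Prime], p ≠ 2 → ∀ (σ : Literature.NumberTheory.GaloisRepresentations.FramedGaloisRep ℚ (PadicAlgCl p) 2) (a b : ℕ), (∀ v : IsDedekindDomain.HeightOneSpectrum (NumberField.RingOfIntegers ℚ), ((p : ℕ) : NumberField.RingOfIntegers ℚ) ∉ v.asIdeal → σ.IsUnramifiedAt v) → Even (a + b) → ¬ ((p : ℤ) - 1 ∣ 2 * ((b : ℤ) - a)) → (∀ g : Field.absoluteGaloisGroup ℚ, ‖Literature.NumberTheory.GaloisRepresentations.FramedRep.trace σ g - ((algebraMap ℚ_[p] (PadicAlgCl p) (((Literature.NumberTheory.GaloisRepresentations.GaloisRep.cyclotomicCharacter ℚ p g : ℤ_[p]ˣ) : ℤ_[p]) : ℚ_[p])) ^ a + (algebraMap ℚ_[p] (PadicAlgCl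 p) (((Literature.NumberTheory.GaloisRepresentations.GaloisRep.cyclotomicCharacter ℚ p g : ℤ_[p]ˣ) : ℤ_[p]) : ℚ_[p])) ^ b)‖ < 1) → ((p : ℤ) ∣ (bernoulli ((((b : ℤ) - a) % ((p : ℤ) - 1)).toNat)).num) → ((p : ℤ) ∣ (bernoulli (p - 1 - (((b : ℤ) - a) % ((p : ℤ) - 1)).toNat)).num) → (∀ (v : IsDedekindDomain.HeightOneSpectrum (NumberField.RingOfIntegers ℚ)) (hv : ((p : ℕ) : NumberField.RingOfIntegers ℚ) ∈ v.asIdeal), (Literature.NumberTheory.PAdicHodge.fontainePstAdicCompletion v p hv).IsDeRhamFramed (σ.toLocal v)) → ¬ Literature.NumberTheory.GaloisRepresentations.FramedRep.IsIrreducible σ := by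
  sorry

/-- **STUB 2 — the non-de Rham (wild) piece.** Same hypotheses and `σ` NOT de Rham at `p` ⟹ `σ`
reducible.  Expected FALSE at every genuine mirror pair (census §0: Weierstrass dichotomy with
Mazur–Böckle finiteness); true only if no mirror pair exists (none below 12288).
[cite: Bockle1999, Thm. 4.14 and Problem 4.13] [cite: Mazur1989Deforming, §1.10] -/
theorem stub_notDeRham :
    ∀ (p : ℕ) [Fact p.Prime], p ≠ 2 → ∀ (σ : Literature.NumberTheory.GaloisRepresentations.FramedGaloisRep ℚ (PadicAlgCl p) 2) (a b : ℕ), (∀ v : IsDedekindDomain.HeightOneSpectrum (NumberField.RingOfIntegers ℚ), ((p : ℕ) : NumberField.RingOfIntegers ℚ) ∉ v.asIdeal → σ.IsUnramifiedAt v) → Even (a + b) → ¬ ((p : ℤ) - 1 ∣ 2 * ((b : ℤ) - a)) → (∀ g : Field.absoluteGaloisGroup ℚ, ‖Literature.NumberTheory.GaloisRepresentations.FramedRep.trace σ g - ((algebraMap ℚ_[p] (PadicAlgCl p) (((Literature.NumberTheory.GaloisRepresentations.GaloisRep.cyclotomicCharacter ℚ p g : ℤ_[p]ˣ) : ℤ_[p])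 : ℚ_[p])) ^ a + (algebraMap ℚ_[p] (PadicAlgCl p) (((Literature.NumberTheory.GaloisRepresentations.GaloisRep.cyclotomicCharacter ℚ p g : ℤ_[p]ˣ) : ℤ_[p]) : ℚ_[p])) ^ b)‖ < 1) → ((p : ℤ) ∣ (bernoulli ((((b : ℤ) - a) % ((p : ℤ) - 1)).toNat)).num) → ((p : ℤ) ∣ (bernoulli (p - 1 - (((b : ℤ) - a) % ((p : ℤ) - 1)).toNat)).num) → ¬ (∀ (v : IsDedekindDomain.HeightOneSpectrum (NumberField.RingOfIntegers ℚ)) (hv : ((p : ℕ) : NumberField.RingOfIntegers ℚ) ∈ v.asIdeal), (Literature.NumberTheory.PAdicHodge.fontainePstAdicCompletion v p hv).IsDeRhamFramed (σ.toLocal v)) → ¬ Literature.NumberTheory.GaloisRepresentations.FramedRep.IsIrreducible σ := by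
  sorry

/-! ## 2. The stub statements as named `Prop`s (literally their types) -/

namespace _Goal

/-- The statement of `stub_deRham`, as a named `Prop` (literally its type). [folklore] -/
def stub_deRham : Prop :=
  type_of% @Summit.Langlands.Langlands.Cruxes.NonSelfMirrorReducible.DeRham.stub_deRham

/-- The statement of `stub_notDeRham`, as a named `Prop` (literally its type). [folklore] -/
def stub_notDeRham : Prop :=
  type_of% @Summit.Langlands.Langlands.Cruxes.NonSelfMirrorReducible.DeRham.stub_notDeRham

end _Goal

/-! ## 3. The composition (kernel-checked, no `sorry`) -/

/-- **`NonSelfMirrorReducible` from the two stubs**: excluded middle on "`σ` is de Rham at `p`".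
The hypotheses are, by name, the statements of the two stubs; the conclusion is the route decl
`Summit.Langlands.Langlands.Theses.MirrorPairReflection.NonSelfMirrorReducible`. [folklore] -/
theorem NonSelfMirrorReducible_of (hD : _Goal.stub_deRham) (hW : _Goal.stub_notDeRham) :
    Summit.Langlands.Langlands.Theses.MirrorPairReflection.NonSelfMirrorReducible := by
  have hD' : type_of% @stub_deRham := hD
  have hW' : type_of% @stub_notDeRham := hW
  intro p _ hp σ a b hU hE hm hT d1 d2
  by_cases hdR : ∀ (v : IsDedekindDomain.HeightOneSpectrum (NumberField.RingOfIntegers ℚ))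
      (hv : ((p : ℕ) : NumberField.RingOfIntegers ℚ) ∈ v.asIdeal),
      (Literature.NumberTheory.PAdicHodge.fontainePstAdicCompletion v p hv).IsDeRhamFramed (σ.toLocal v)
  · exact hD' p hp σ a b hU hE hm hT d1 d2 hdR
  · exact hW' p hp σ a b hU hE hm hT d1 d2 hdR

/-- Converse: each stub is a restriction of the crux (so neither is stronger than the crux).
[folklore] -/
theorem stubs_of_NonSelfMirrorReducible
    (h : Summit.Langlands.Langlands.Theses.MirrorPairReflection.NonSelfMirrorReducible) :
    _Goal.stub_deRham ∧ _Goal.stub_notDeRham := by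
  refine ⟨?_, ?_⟩
  · show type_of% @stub_deRham
    exact fun p _ hp σ a b hU hE hm hT d1 d2 _ => h p hp σ a b hU hE hm hT d1 d2
  · show type_of% @stub_notDeRham
    exact fun p _ hp σ a b hU hE hm hT d1 d2 _ => h p hp σ a b hU hE hm hT d1 d2

/-- By-name sanity check (an `example`, not a declaration): the two stubs feed the composition as
they stand. -/
example : Summit.Langlands.Langlands.Theses.MirrorPairReflection.NonSelfMirrorReducible :=
  NonSelfMirrorReducible_of stub_deRham stub_notDeRham

end Summit.Langlands.Langlands.Cruxes.NonSelfMirrorReducible.DeRham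

end
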